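import Summits.CriticalPhenomena.Ising3DConformalLimit.Theorems.PerfectScreeningSubharmonicOffOriginStubBandSubharmonic

/-!
# LSC ⇒ axial subharmonicity (crux `SubharmonicOffOrigin`, stmt-CriticalPhenomena-1341; line
`kl-band-positivity`, lead by-product)

Registered sub-goal `lsc_axial_subharmonic` of stmt-CriticalPhenomena-1341.  For ANY function
`G : ℤ³ → ℝ` with a joint spectral representation `G(x) = ∫ λ^{|x_{i₀}|} cos(k·x̌) dρ(λ,k)` in a
direction `i₀` (`Represents`, finite `ρ` carried by the window `λ ∈ (0,1]`) obeying the LATTICE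
SPECTRAL CONDITION (`ρ lscViolating = 0`: no weight of negative free invariant mass
`s(λ,k) = λ + 1/λ − 2 − k̂²`), the lattice Laplacian of `G` is nonnegative at every site of the
`i₀`-AXIS off the origin: for `x = n e_{i₀}`, `n ≠ 0`,
`∑_nbrs G − 6 G(x) = ∫ λ^{|n|−1} (λ² − (2+k̂²)λ + 1) dρ = ∫ λ^{|n|} s(λ,k) dρ ≥ 0`
(on the axis every phase `cos(k·x̌)` is `1` at `x` and `cos kⱼ` at the transverse neighbours, and
`∑ⱼ 2cos kⱼ = 4 − k̂²`).  This is the "mean-LSC ⇒ axial SubH" mechanism of the crux idea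
`mirror-mean-lsc` and of the route dossier, typed over the joint measure; with the landed
`stub_jointSpectralMeasure` it gives: LSC for the critical 3D Ising two-point function in direction
`i₀` ⇒ SubH on the `i₀`-axis.  Off the axes the phase `cos(k·x̌)` has no sign and nothing is claimed
(the NNN-Gaussian `G_a` of triage r1-2 has exact axial LSC and fails SubH at `(1,1,0)`).
-/

noncomputable section

open MeasureTheory ProbabilityTheory
open Literature.Probability.LatticeModels

namespace Summit.CriticalPhenomena.Ising3DConformalLimit.Theorems.PerfectScreening.KlBand

/-! Throughout, the joint-measure integrand at a site `z` is the function
`p ↦ p.1 ^ (z i₀).natAbs * Real.cos (phase p.2 (perp i₀ z))` of the spectral point `p = (λ,k)`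
(written out in full; no auxiliary definition). -/

/-- The joint integrand is continuous in `p`. -/
private theorem continuous_jointIntegrand (i₀ : Fin 3) (z : Site 3) :
    Continuous (fun p : ℝ × (Fin 2 → ℝ) => p.1 ^ ((z) i₀).natAbs * Real.cos (phase p.2 (perp i₀ (z)))) := by
  have h1 : Continuous fun p : ℝ × (Fin 2 → ℝ) => phase p.2 (perp i₀ z) :=
    (bandSub_continuous_phase _).comp continuous_snd
  fun_prop

/-- On the spectral window the joint integrand is bounded by `1`. -/
private theorem abs_jointIntegrand_le {i₀ : Fin 3} {z : Site 3} {p : ℝ × (Fin 2 → ℝ)}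
    (hp : p ∈ specWindow) : |p.1 ^ ((z) i₀).natAbs * Real.cos (phase p.2 (perp i₀ (z)))| ≤ 1 := by
  obtain ⟨⟨h0, h1⟩, -⟩ := hp
  rw [abs_mul]
  have ha : |p.1 ^ (z i₀).natAbs| ≤ 1 := by
    rw [abs_pow]
    exact pow_le_one₀ (abs_nonneg _) (abs_le.2 ⟨by linarith, h1⟩)
  have hb : |Real.cos (phase p.2 (perp i₀ z))| ≤ 1 := Real.abs_cos_le_one _
  nlinarith [abs_nonneg (p.1 ^ (z i₀).natAbs), abs_nonneg (Real.cos (phase p.2 (perp i₀ z)))]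

/-- A measure carried by the spectral window charges only window points. -/
private theorem ae_mem_specWindow {ρ : Measure (ℝ × (Fin 2 → ℝ))} (hwin : ρ specWindowᶜ = 0) :
    ∀ᵐ p ∂ρ, p ∈ specWindow := by
  have h : ∀ᵐ p ∂ρ, p ∉ specWindowᶜ := measure_eq_zero_iff_ae_notMem.1 hwin
  filter_upwards [h] with p hp
  simpa using hp

/-- `k·0 = 0`. -/
private theorem phase_zero (k : Fin 2 → ℝ) : phase k 0 = 0 := by
  simp [phase]

/-- `k·(−y) = −k·y`. -/
private theorem phase_neg (k : Fin 2 → ℝ) (y : Fin 2 → ℤ) : phase k (-y) = -phase k y := by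
  simp [phase, Finset.sum_neg_distrib, mul_neg]

/-- The joint integrand is integrable against a finite measure carried by the window. -/
private theorem integrable_jointIntegrand (i₀ : Fin 3) (z : Site 3) (ρ : Measure (ℝ × (Fin 2 → ℝ)))
    [IsFiniteMeasure ρ] (hwin : ρ specWindowᶜ = 0) : Integrable (fun p : ℝ × (Fin 2 → ℝ) => p.1 ^ ((z) i₀).natAbs * Real.cos (phase p.2 (perp i₀ (z)))) ρ := by
  refine Integrable.mono' (integrable_const (1 : ℝ))
    (continuous_jointIntegrand i₀ z).aestronglyMeasurable ?_
  filter_upwards [ae_mem_specWindow hwin] with p hp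
  rw [Real.norm_eq_abs]
  exact abs_jointIntegrand_le hp

/-- **Pointwise identity on the axis.** At a spectral point with `λ ≠ 0` and a site `x` of the
`i₀`-axis (`x̌ = 0`, `x_{i₀} ≠ 0`), the 7-point stencil applied to `λ^{|z_{i₀}|} cos(k·ž)` gives
`λ^{|x_{i₀}|}·s(λ,k)` with `s` the free invariant mass. -/
private theorem axial_pointwise (i₀ : Fin 3) (x : Site 3) (hx : x i₀ ≠ 0) (hperp : perp i₀ x = 0)
    (p : ℝ × (Fin 2 → ℝ)) (hp : p.1 ≠ 0) :
    (∑ i : Fin 3, (p.1 ^ ((x + Pi.single i 1 : Site 3) i₀).natAbs * Real.cos (phase p.2 (perp i₀ (x + Pi.single i 1)))) +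
        ∑ i : Fin 3, (p.1 ^ ((x - Pi.single i 1 : Site 3) i₀).natAbs * Real.cos (phase p.2 (perp i₀ (x - Pi.single i 1))))) - 6 * (p.1 ^ ((x) i₀).natAbs * Real.cos (phase p.2 (perp i₀ (x)))) =
      p.1 ^ (x i₀).natAbs * freeMass p := by
  obtain ⟨M, hM⟩ : ∃ M, (x i₀).natAbs = M + 1 :=
    Nat.exists_eq_add_one_of_ne_zero (Int.natAbs_ne_zero.mpr hx)
  have hkh : khatSq p.2 = 2 * (1 - Real.cos (p.2 0)) + 2 * (1 - Real.cos (p.2 1)) := by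
    simp [khatSq]
  have hpm : p.1 ^ (x i₀ + 1).natAbs + p.1 ^ (x i₀ - 1).natAbs = p.1 ^ (M + 2) + p.1 ^ M := by
    rcases lt_or_gt_of_ne hx with h | h
    · rw [show (x i₀ + 1).natAbs = M by omega, show (x i₀ - 1).natAbs = M + 2 by omega, add_comm]
    · rw [show (x i₀ + 1).natAbs = M + 2 by omega, show (x i₀ - 1).natAbs = M by omega]
  have h0 : (p.1 ^ ((x) i₀).natAbs * Real.cos (phase p.2 (perp i₀ (x)))) = p.1 ^ (M + 1) := by
    simp [hperp, phase_zero, hM]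
  have hplus : (p.1 ^ ((x + Pi.single i₀ 1 : Site 3) i₀).natAbs * Real.cos (phase p.2 (perp i₀ (x + Pi.single i₀ 1)))) = p.1 ^ (x i₀ + 1).natAbs := by
    simp [bandSub_perp_add_single_self, hperp, phase_zero]
  have hminus : (p.1 ^ ((x - Pi.single i₀ 1 : Site 3) i₀).natAbs * Real.cos (phase p.2 (perp i₀ (x - Pi.single i₀ 1)))) = p.1 ^ (x i₀ - 1).natAbs := by
    simp [bandSub_perp_sub_single_self, hperp, phase_zero]
  have htadd : ∀ j : Fin 2, (p.1 ^ ((x + Pi.single (i₀.succAbove j) 1 : Site 3) i₀).natAbs * Real.cos (phase p.2 (perp i₀ (x + Pi.single (i₀.succAbove j) 1)))) =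
      p.1 ^ (M + 1) * Real.cos (p.2 j) := by
    intro j
    simp [bandSub_perp_add_single_succAbove, hperp, bandSub_phase_single, hM]
  have htsub : ∀ j : Fin 2, (p.1 ^ ((x - Pi.single (i₀.succAbove j) 1 : Site 3) i₀).natAbs * Real.cos (phase p.2 (perp i₀ (x - Pi.single (i₀.succAbove j) 1)))) =
      p.1 ^ (M + 1) * Real.cos (p.2 j) := by
    intro j
    simp [bandSub_perp_sub_single_succAbove, hperp, phase_neg, bandSub_phase_single,
      Real.cos_neg, hM]
  rw [Fin.sum_univ_succAbove _ i₀, Fin.sum_univ_succAbove _ i₀, Fin.sum_univ_two, Fin.sum_univ_two,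
    hplus, hminus, htadd, htadd, htsub, htsub, h0, hM, freeMass, hkh]
  have key : p.1 ^ (M + 2) + p.1 ^ M = p.1 ^ (M + 1) * (p.1 + p.1⁻¹) := by
    field_simp
    ring
  linear_combination hpm + key

/-- **LSC ⇒ axial subharmonicity** (registered sub-goal `lsc_axial_subharmonic` of
stmt-CriticalPhenomena-1341).  If `G` has a joint spectral representation in direction `i₀` by a
finite measure on the window `(0,1] × ℝ²` charging no negative free invariant mass, then
`6·G(x) ≤ ∑ᵢ (G(x+eᵢ) + G(x−eᵢ))` at every `x` of the `i₀`-axis off the origin. -/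
theorem lsc_axial_subharmonic :
    ∀ (G : Site 3 → ℝ) (i₀ : Fin 3) (ρ : Measure (ℝ × (Fin 2 → ℝ))), IsFiniteMeasure ρ →
      ρ specWindowᶜ = 0 → ρ lscViolating = 0 → Represents i₀ G ρ →
        ∀ x : Site 3, x i₀ ≠ 0 → perp i₀ x = 0 →
          6 * G x ≤ ∑ i : Fin 3, (G (x + Pi.single i 1) + G (x - Pi.single i 1)) := by
  intro G i₀ ρ hfin hwin hlsc hrep x hx hperp
  have hI : ∀ z : Site 3, Integrable (fun p : ℝ × (Fin 2 → ℝ) => p.1 ^ ((z) i₀).natAbs * Real.cos (phase p.2 (perp i₀ (z)))) ρ :=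
    fun z => integrable_jointIntegrand i₀ z ρ hwin
  have hG : ∀ z : Site 3, G z = ∫ p, (p.1 ^ ((z) i₀).natAbs * Real.cos (phase p.2 (perp i₀ (z)))) ∂ρ := fun z => hrep z
  -- the Laplacian of `G` at `x` as ONE integral
  have hsum : (∑ i : Fin 3, (G (x + Pi.single i 1) + G (x - Pi.single i 1))) - 6 * G x =
      ∫ p, ((∑ i : Fin 3, (p.1 ^ ((x + Pi.single i 1 : Site 3) i₀).natAbs * Real.cos (phase p.2 (perp i₀ (x + Pi.single i 1)))) +
          ∑ i : Fin 3, (p.1 ^ ((x - Pi.single i 1 : Site 3) i₀).natAbs * Real.cos (phase p.2 (perp i₀ (x - Pi.single i 1))))) - 6 * (p.1 ^ ((x) i₀).natAbs * Real.cos (phase p.2 (perp i₀ (x))))) ∂ρ := by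
    simp only [hG]
    rw [Finset.sum_add_distrib, ← integral_finsetSum _ fun i _ => hI _,
      ← integral_finsetSum _ fun i _ => hI _, ← integral_const_mul,
      ← integral_add (integrable_finsetSum _ fun i _ => hI _)
        (integrable_finsetSum _ fun i _ => hI _),
      ← integral_sub ((integrable_finsetSum _ fun i _ => hI _).fun_add
        (integrable_finsetSum _ fun i _ => hI _)) ((hI x).const_mul 6)]
  -- a.e. the integrand is `λ^{|n|}·s(λ,k) ≥ 0`
  have hae : ∀ᵐ p ∂ρ, 0 ≤ (∑ i : Fin 3, (p.1 ^ ((x + Pi.single i 1 : Site 3) i₀).natAbs * Real.cos (phase p.2 (perp i₀ (x + Pi.single i 1)))) +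
      ∑ i : Fin 3, (p.1 ^ ((x - Pi.single i 1 : Site 3) i₀).natAbs * Real.cos (phase p.2 (perp i₀ (x - Pi.single i 1))))) - 6 * (p.1 ^ ((x) i₀).natAbs * Real.cos (phase p.2 (perp i₀ (x)))) := by
    have hlsc' : ∀ᵐ p ∂ρ, p ∉ lscViolating := measure_eq_zero_iff_ae_notMem.1 hlsc
    filter_upwards [ae_mem_specWindow hwin, hlsc'] with p hp hl
    obtain ⟨⟨h0, -⟩, -⟩ := hp
    rw [axial_pointwise i₀ x hx hperp p h0.ne']
    have hs : 0 ≤ freeMass p := by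
      simpa [lscViolating] using hl
    exact mul_nonneg (pow_nonneg h0.le _) hs
  have h := integral_nonneg_of_ae hae
  rw [← hsum] at h
  linarith

end Summit.CriticalPhenomena.Ising3DConformalLimit.Theorems.PerfectScreening.KlBand

end
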